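import Literature.NumberTheory.DiophantineGeometry.SumsOfUnitsCubeProofs
import HarnessLib

/-!
# von Känel–Matschke, Corollary 9.3 with the optimized bound `Ω = 3Ω_opt(1, S) + 9 log N_S` (proofs)

Topic `Literature/NumberTheory/DiophantineGeometry` (family `abc`). A proofs-only companion (theorems only; NO
definition, NO new named fact; D-0014, D-0026) of `OptimizedHeightBoundsModularity.lean`, where **Corollary 9.3**
(`cor:sumsofunits`) of R. von Känel, B. Matschke, arXiv:1605.06079 = Mem. AMS 286 (2023) [`VonkanelMatschke2023`] is
typed with the printed bound `Ω = 3Ω_opt(1, S) + 9 log N_S` as `corollary_9_3` (the weaker rendering with `Ω_sim`,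
`corollary_9_3_sim`, is proved in `SumsOfUnitsSquareProofs` / `SumsOfUnitsCubeProofs`).

The printed §9 proofs of (claimsquare) and (claimcube) use the bound only through two properties: the shape of
Cor. 9.1 (`h(x²), h(y) ≤ 3Ω(bc², S) + 3h(c) + 8 log N_S`), resp. of the Mordell bound
(`max(h(x), (2/3)h(y)) ≤ Ω(a, S)`), and `Ω(a, S) = ⅓h(a) + Ω(1, S)` for `a ∈ 𝒪^×` (both `Ω_sim` and `Ω_opt` depend
on `a` only through `⅓h(a)` and `a_S`, and `a_S = 1_S` for `a ∈ 𝒪^×`). This file re-runs those proofs for an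
ARBITRARY `Ω : Finset ℕ → ℚ → ℝ` with these two properties (`claimsquare_general`, `claimcube_general`,
`corollary_9_3_i_general`, `corollary_9_3_ii_general`) and specialises to `Ω_opt`:

* `corollary_9_3_of_corollary_9_1_of_mordell_omegaOpt (h91 : corollary_9_1) (hMo : Mordell half of Prop. 10.7)`;
* `corollary_9_3_of_proposition_10_7 (h91 : corollary_9_1) (h107 : proposition_10_7)`;
* `corollary_9_3_of_roots (hmod) (h103) (hi) : corollary_9_3` — from {modularity, Lemma 10.3, Prop. 10.8 (i)} via
  `corollary_9_1_of_roots` and `mordell_height_le_omegaOpt_of_lemma_10_3`.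

[The printed proofs: §9, proof of Cor. 9.3, displays (claimsquare), (claimcube).] No `abc` claim; axioms standard.
-/

noncomputable section

open Height
open Literature.NumberTheory.EllipticCurves.ModularForms

namespace Literature.NumberTheory.DiophantineGeometry

namespace VonKanelMatschke

/-- Integers have `ord_p ≥ 0`. [folklore] -/
private theorem padicValRat_intCast_nonneg₀ (p : ℕ) (z : ℤ) : 0 ≤ padicValRat p (z : ℚ) := by
  rw [padicValRat.of_int]; exact_mod_cast Nat.zero_le _

/-- `h(n) = log|n|` for a nonzero integer. [folklore] -/
private theorem logHeight₁_intCast_eq₀ {n : ℤ} (hn : n ≠ 0) : logHeight₁ (n : ℚ) = Real.log |(n : ℝ)| := by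
  rw [Rat.logHeight₁_eq_log_max]
  have h1 : 1 ≤ n.natAbs := Nat.one_le_iff_ne_zero.mpr (Int.natAbs_ne_zero.mpr hn)
  simp [max_eq_left h1, Nat.cast_natAbs, Int.cast_abs]

/-! ### The generic claims -/

/-- **(claimsquare), generic in the bound `Ω`** (PROVED from the Cor. 9.1 shape `h91` and `Ω(a) = ⅓h(a) + Ω(1)` on `𝒪^×`): *"If `m, n` are in `ℤ ∩ 𝒪^×` with `m + n` a perfect square and
`gcd(m, n)` square-free, then `h(n) ≤ Ω`"*, with `Ω' = 3Ω(1, S) + 9 log N_S`.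
[cite: VonkanelMatschke2023, §9 (proof of Cor. 9.3 (i), display (claimsquare))] -/
theorem claimsquare_general (Ω : Finset ℕ → ℚ → ℝ)
    (h91 : ∀ (S : Finset ℕ), (∀ p ∈ S, p.Prime) → ∀ b c : ℚ, b ≠ 0 → c ≠ 0 → IsSInteger S b →
      IsSInteger S c → ∀ x y : ℚ, IsSInteger S x → IsSUnit S y → x ^ 2 + b = c * y →
        max (logHeight₁ (x ^ 2)) (logHeight₁ y) ≤ 3 * Ω S (b * c ^ 2) + 3 * logHeight₁ c + 8 * Real.log (primesProd S))
    (hΩ : ∀ (S : Finset ℕ) (a : ℚ), IsSUnit S a → Ω S a = 1 / 3 * logHeight₁ a + Ω S 1)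
    {S : Finset ℕ} (hS : ∀ p ∈ S, p.Prime) {m n l : ℤ}
    (hm : IsSUnit S (m : ℚ)) (hn : IsSUnit S (n : ℚ)) (hl : l ^ 2 = m + n)
    (hsf : ∀ p : ℕ, p.Prime → ¬ ((p : ℤ) ^ 2 ∣ m ∧ (p : ℤ) ^ 2 ∣ n)) :
    logHeight₁ (n : ℚ) ≤ 3 * Ω S 1 + 9 * Real.log (primesProd S) := by
  obtain ⟨M, m₀, hM0, hmeq, hMS, hm₀S, hhm₀⟩ := exists_sq_mul_of_isSUnit_int hS hm
  have hn0 : n ≠ 0 := by have := hn.1; exact_mod_cast this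
  have hm₀0 : (m₀ : ℚ) ≠ 0 := hm₀S.1
  have hMq0 : (M : ℚ) ≠ 0 := hMS.1
  set x : ℚ := (l : ℚ) / M with hx
  set y : ℚ := (n : ℚ) / (M : ℚ) ^ 2 with hy
  -- the equation `x² + (−m₀) = 1 · y`
  have hl' : (l : ℚ) ^ 2 = (M : ℚ) ^ 2 * m₀ + n := by rw [hmeq] at hl; exact_mod_cast hl
  have heq : x ^ 2 + (-(m₀ : ℚ)) = 1 * y := by
    rw [hx, hy, div_pow, hl']; field_simp; ring
  -- `x ∈ 𝒪`, `y ∈ 𝒪^×`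
  have hxS : IsSInteger S x := by
    by_cases hl0 : l = 0
    · rw [hx, hl0]; simpa using isSInteger_intCast S 0
    · refine isSInteger_of_padicValRat_nonneg fun p hp hpS => ?_
      haveI : Fact p.Prime := ⟨hp⟩
      rw [hx, padicValRat.div (by exact_mod_cast hl0) hMq0, padicValRat_eq_zero_of_isSUnit hMS hp hpS,
        sub_zero]
      exact padicValRat_intCast_nonneg₀ p l
  have hy0 : y ≠ 0 := div_ne_zero (by exact_mod_cast hn0) (pow_ne_zero 2 hMq0)
  have hyS : IsSUnit S y := isSUnit_of_padicValRat_eq_zero hy0 fun p hp hpS => by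
    haveI : Fact p.Prime := ⟨hp⟩
    rw [hy, padicValRat.div (by exact_mod_cast hn0) (pow_ne_zero 2 hMq0), padicValRat.pow,
      padicValRat_eq_zero_of_isSUnit hn hp hpS, padicValRat_eq_zero_of_isSUnit hMS hp hpS]; simp
  -- Corollary 9.1 with `b = −m₀`, `c = 1`
  have hb : IsSInteger S (-(m₀ : ℚ)) := by
    have := isSInteger_intCast S (-m₀); push_cast at this; exact this
  have hc : IsSInteger S (1 : ℚ) := by simpa using isSInteger_intCast S 1
  have h := h91 S hS (-(m₀ : ℚ)) 1 (neg_ne_zero.mpr hm₀0) one_ne_zero hb hc x y hxS hyS heq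
  rw [one_pow, mul_one, hΩ S _ hm₀S.neg, logHeight₁_neg, logHeight₁_one, mul_zero, add_zero] at h
  have hyb : logHeight₁ y ≤ 3 * Ω S 1 + 9 * Real.log (primesProd S) := by
    have := (le_max_right _ _).trans h; linarith
  -- `h(n) ≤ h(y)` since `gcd(n, M) = 1`
  have hcop : IsCoprime n M := by
    rw [Int.isCoprime_iff_gcd_eq_one]
    by_contra hg
    obtain ⟨p, hp, hpg⟩ := Nat.exists_prime_and_dvd hg
    have hpn : (p : ℤ) ∣ n := (Int.natCast_dvd_natCast.mpr hpg).trans (Int.gcd_dvd_left _ _)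
    have hpM : (p : ℤ) ∣ M := (Int.natCast_dvd_natCast.mpr hpg).trans (Int.gcd_dvd_right _ _)
    have hp2m : (p : ℤ) ^ 2 ∣ m := hmeq ▸ (pow_dvd_pow_of_dvd hpM 2).mul_right m₀
    have hpl : (p : ℤ) ∣ l := by
      have : (p : ℤ) ∣ l ^ 2 := by rw [hl]; exact dvd_add (dvd_trans (dvd_pow_self _ two_ne_zero) hp2m) hpn
      exact (Nat.prime_iff_prime_int.mp hp).dvd_of_dvd_pow this
    have hp2n : (p : ℤ) ^ 2 ∣ n := by
      have : (p : ℤ) ^ 2 ∣ m + n := hl ▸ pow_dvd_pow_of_dvd hpl 2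
      exact (dvd_add_right hp2m).mp this
    exact hsf p hp ⟨hp2m, hp2n⟩
  have hM2 : (0 : ℤ) < M ^ 2 := by positivity
  have hyeq : logHeight₁ y = Real.log ((max |n| (M ^ 2) : ℤ) : ℝ) := by
    rw [hy, ← MurtyPasten.logHeight₁_div_eq hM2 (hcop.pow_right (n := 2))]; push_cast; ring_nf
  have hnle : logHeight₁ (n : ℚ) ≤ logHeight₁ y := by
    rw [hyeq, logHeight₁_intCast_eq₀ hn0]
    refine Real.log_le_log (abs_pos.mpr (by exact_mod_cast hn0)) ?_
    have : |n| ≤ max |n| (M ^ 2) := le_max_left _ _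
    have h' : ((|n| : ℤ) : ℝ) ≤ ((max |n| (M ^ 2) : ℤ) : ℝ) := by exact_mod_cast this
    rwa [Int.cast_abs] at h'
  exact hnle.trans hyb


/-- **vKM Corollary 9.3 (i), generic in `Ω`** (PROVED; `Ω' = 3Ω(1, S) + 9 log N_S`): *"If `u + v` is a square
in `ℚ`, then there is `ε ∈ 𝒪^×` such that `h(ε²u), h(ε²v) ≤ Ω`."* — by (claimsquare) applied to `(ε²u, ε²v)` and
`(ε²v, ε²u)`. [cite: VonkanelMatschke2023, Cor. 9.3 (i) (arXiv §9, cor:sumsofunits)] -/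
theorem corollary_9_3_i_general (Ω : Finset ℕ → ℚ → ℝ)
    (h91 : ∀ (S : Finset ℕ), (∀ p ∈ S, p.Prime) → ∀ b c : ℚ, b ≠ 0 → c ≠ 0 → IsSInteger S b →
      IsSInteger S c → ∀ x y : ℚ, IsSInteger S x → IsSUnit S y → x ^ 2 + b = c * y →
        max (logHeight₁ (x ^ 2)) (logHeight₁ y) ≤ 3 * Ω S (b * c ^ 2) + 3 * logHeight₁ c + 8 * Real.log (primesProd S))
    (hΩ : ∀ (S : Finset ℕ) (a : ℚ), IsSUnit S a → Ω S a = 1 / 3 * logHeight₁ a + Ω S 1)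
    {S : Finset ℕ}
    (hS : ∀ p ∈ S, p.Prime) {u v : ℚ} (hu : IsSUnit S u) (hv : IsSUnit S v) (hsq : IsSquare (u + v)) :
    ∃ ε : ℚ, IsSUnit S ε ∧
      max (logHeight₁ (ε ^ 2 * u)) (logHeight₁ (ε ^ 2 * v)) ≤
        3 * Ω S 1 + 9 * Real.log (primesProd S) := by
  obtain ⟨ε, m, n, hεS, hm, hn, hmS, hnS, hsf⟩ := exists_isSUnit_sq_mul_pair hS hu hv
  obtain ⟨r, hr⟩ := hsq
  -- `m + n = (ε r)²` is a perfect square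
  have hsq' : IsSquare (((m + n : ℤ)) : ℚ) := ⟨ε * r, by push_cast; rw [← hm, ← hn, ← mul_add, hr]; ring⟩
  obtain ⟨l, hl⟩ := (Rat.isSquare_iff.mp hsq').1
  rw [Rat.num_intCast] at hl
  have hl2 : l ^ 2 = m + n := by rw [hl]; ring
  have h1 := claimsquare_general Ω h91 hΩ hS hmS hnS hl2 hsf
  have h2 := claimsquare_general Ω h91 hΩ hS hnS hmS (by rw [hl2, add_comm]) fun p hp h => hsf p hp ⟨h.2, h.1⟩
  refine ⟨ε, hεS, ?_⟩
  rw [hm, hn]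
  exact max_le h2 h1

/-- **(claimcube), generic in the bound `Ω`** (PROVED from the Mordell shape `hMo` and `Ω(a) = ⅓h(a) + Ω(1)` on `𝒪^×`): *"If `m, n` are in `ℤ ∩ 𝒪^×` with `m + n` a perfect cube and
`gcd(m, n)` cube-free, then `h(n) ≤ Ω`"*, with `Ω' = 3Ω(1, S) + 9 log N_S` (in fact `+ 8 log N_S`).
[cite: VonkanelMatschke2023, §9 (proof of Cor. 9.3 (ii), display (claimcube))] -/
theorem claimcube_general (Ω : Finset ℕ → ℚ → ℝ)
    (hMo : ∀ (S : Finset ℕ), (∀ p ∈ S, p.Prime) → ∀ a : ℚ, a ≠ 0 → IsSInteger S a →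
      ∀ x y : ℚ, IsSInteger S x → IsSInteger S y → y ^ 2 = x ^ 3 + a →
        max (logHeight₁ x) (2 / 3 * logHeight₁ y) ≤ Ω S a)
    (hΩ : ∀ (S : Finset ℕ) (a : ℚ), IsSUnit S a → Ω S a = 1 / 3 * logHeight₁ a + Ω S 1)
    {S : Finset ℕ} (hS : ∀ p ∈ S, p.Prime) {m n l : ℤ}
    (hm : IsSUnit S (m : ℚ)) (hn : IsSUnit S (n : ℚ)) (hl : l ^ 3 = m + n)
    (hcf : ∀ p : ℕ, p.Prime → ¬ ((p : ℤ) ^ 3 ∣ m ∧ (p : ℤ) ^ 3 ∣ n)) :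
    logHeight₁ (n : ℚ) ≤ 3 * Ω S 1 + 9 * Real.log (primesProd S) := by
  obtain ⟨M, m₀, hMpos, hmeq, hMS, hm₀S, hhm₀⟩ := exists_cube_mul_of_isSUnit_int hS hm
  have hn0 : n ≠ 0 := by have := hn.1; exact_mod_cast this
  have hm₀0 : (m₀ : ℚ) ≠ 0 := hm₀S.1
  have hMq0 : (M : ℚ) ≠ 0 := hMS.1
  have hlogN : 0 ≤ Real.log (primesProd S) :=
    Real.log_nonneg (by exact_mod_cast one_le_primesProd hS)
  set x : ℚ := (l : ℚ) / M with hx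
  set y : ℚ := (n : ℚ) / (M : ℚ) ^ 3 with hy
  have hl' : (l : ℚ) ^ 3 = (M : ℚ) ^ 3 * m₀ + n := by rw [hmeq] at hl; exact_mod_cast hl
  have hxy : x ^ 3 - m₀ = y := by
    rw [hx, hy, div_pow, hl']; field_simp; ring
  -- `x ∈ 𝒪`, `y ∈ 𝒪^×`
  have hxS : IsSInteger S x := by
    by_cases hl0 : l = 0
    · rw [hx, hl0]; simpa using isSInteger_intCast S 0
    · refine isSInteger_of_padicValRat_nonneg fun p hp hpS => ?_
      haveI : Fact p.Prime := ⟨hp⟩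
      rw [hx, padicValRat.div (by exact_mod_cast hl0) hMq0, padicValRat_eq_zero_of_isSUnit hMS hp hpS,
        sub_zero]
      exact padicValRat_intCast_nonneg₀ p l
  have hy0 : y ≠ 0 := div_ne_zero (by exact_mod_cast hn0) (pow_ne_zero 3 hMq0)
  have hyS : IsSUnit S y := isSUnit_of_padicValRat_eq_zero hy0 fun p hp hpS => by
    haveI : Fact p.Prime := ⟨hp⟩
    rw [hy, padicValRat.div (by exact_mod_cast hn0) (pow_ne_zero 3 hMq0), padicValRat.pow,
      padicValRat_eq_zero_of_isSUnit hn hp hpS, padicValRat_eq_zero_of_isSUnit hMS hp hpS]; simp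
  -- `y = w y'²`, the Mordell equation `Y² = X³ + a`, `X = xw`, `Y = y'w²`, `a = −m₀w³`
  obtain ⟨w, y', hwS, hy'S, hyw, hhw⟩ := exists_eq_int_mul_sq_of_isSUnit hS hyS
  have hw0 : (w : ℚ) ≠ 0 := hwS.1
  set X : ℚ := x * w with hX
  set Y : ℚ := y' * (w : ℚ) ^ 2 with hY
  set a : ℚ := -(m₀ : ℚ) * (w : ℚ) ^ 3 with ha
  have ha0 : a ≠ 0 := mul_ne_zero (neg_ne_zero.mpr hm₀0) (pow_ne_zero 3 hw0)
  have haS : IsSUnit S a := by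
    refine isSUnit_of_padicValRat_eq_zero ha0 fun p hp hpS => ?_
    haveI : Fact p.Prime := ⟨hp⟩
    rw [ha, padicValRat.mul (neg_ne_zero.mpr hm₀0) (pow_ne_zero 3 hw0), padicValRat.neg, padicValRat.pow,
      padicValRat_eq_zero_of_isSUnit hm₀S hp hpS, padicValRat_eq_zero_of_isSUnit hwS hp hpS]; simp
  have hXY : Y ^ 2 = X ^ 3 + a := by
    have e1 : y' ^ 2 = y / w := by rw [hyw]; field_simp
    rw [hY, hX, ha, mul_pow, e1, ← hxy]; field_simp; ring
  have hXS : IsSInteger S X := isSInteger_mul hxS hwS.isSInteger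
  have hYS : IsSInteger S Y := by
    refine isSInteger_of_padicValRat_nonneg fun p hp hpS => ?_
    haveI : Fact p.Prime := ⟨hp⟩
    rw [hY, padicValRat.mul hy'S.1 (pow_ne_zero 2 hw0), padicValRat.pow,
      padicValRat_eq_zero_of_isSUnit hy'S hp hpS, padicValRat_eq_zero_of_isSUnit hwS hp hpS]; simp
  -- Prop. 10.1: `max(h(X), (2/3)h(Y)) ≤ Ω_sim(a, S) = (1/3)h(a) + Ω_sim(1, S)`, `h(a) ≤ 5 log N_S`
  have hMordell := hMo S hS a ha0 haS.isSInteger X Y hXS hYS hXY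
  rw [hΩ S a haS] at hMordell
  have hha : logHeight₁ a ≤ 5 * Real.log (primesProd S) := by
    have h1 := logHeight₁_mul_le (-(m₀ : ℚ)) ((w : ℚ) ^ 3)
    rw [logHeight₁_neg, logHeight₁_pow] at h1
    rw [ha]; push_cast at h1 ⊢; linarith
  have hY' : logHeight₁ Y ≤ 3 / 2 * Ω S 1 + 5 / 2 * Real.log (primesProd S) := by
    have := (le_max_right _ _).trans hMordell; linarith
  -- `h(y) ≤ 2h(Y) + 3h(w)`
  have hyY : y = Y ^ 2 / (w : ℚ) ^ 3 := by rw [hY, hyw]; field_simp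
  have hhy : logHeight₁ y ≤ 2 * logHeight₁ Y + 3 * logHeight₁ (w : ℚ) := by
    have h1 := logHeight₁_mul_le (Y ^ 2) (((w : ℚ) ^ 3)⁻¹)
    rw [← div_eq_mul_inv, ← hyY, logHeight₁_inv, logHeight₁_pow, logHeight₁_pow] at h1
    push_cast at h1; linarith
  have hyb : logHeight₁ y ≤ 3 * Ω S 1 + 9 * Real.log (primesProd S) := by linarith
  -- `h(n) ≤ h(y)` since `gcd(n, M) = 1`
  have hcop : IsCoprime n M := by
    rw [Int.isCoprime_iff_gcd_eq_one]
    by_contra hg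
    obtain ⟨p, hp, hpg⟩ := Nat.exists_prime_and_dvd hg
    have hpn : (p : ℤ) ∣ n := (Int.natCast_dvd_natCast.mpr hpg).trans (Int.gcd_dvd_left _ _)
    have hpM : (p : ℤ) ∣ M := (Int.natCast_dvd_natCast.mpr hpg).trans (Int.gcd_dvd_right _ _)
    have hp3m : (p : ℤ) ^ 3 ∣ m := hmeq ▸ (pow_dvd_pow_of_dvd hpM 3).mul_right m₀
    have hpl : (p : ℤ) ∣ l := by
      have : (p : ℤ) ∣ l ^ 3 := by
        rw [hl]; exact dvd_add (dvd_trans (dvd_pow_self _ three_ne_zero) hp3m) hpn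
      exact (Nat.prime_iff_prime_int.mp hp).dvd_of_dvd_pow this
    have hp3n : (p : ℤ) ^ 3 ∣ n := by
      have : (p : ℤ) ^ 3 ∣ m + n := hl ▸ pow_dvd_pow_of_dvd hpl 3
      exact (dvd_add_right hp3m).mp this
    exact hcf p hp ⟨hp3m, hp3n⟩
  have hM3 : (0 : ℤ) < M ^ 3 := by positivity
  have hyeq : logHeight₁ y = Real.log ((max |n| (M ^ 3) : ℤ) : ℝ) := by
    rw [hy, ← MurtyPasten.logHeight₁_div_eq hM3 (hcop.pow_right (n := 3))]; push_cast; ring_nf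
  have hnle : logHeight₁ (n : ℚ) ≤ logHeight₁ y := by
    rw [hyeq, logHeight₁_intCast_eq₀ hn0]
    refine Real.log_le_log (abs_pos.mpr (by exact_mod_cast hn0)) ?_
    have : |n| ≤ max |n| (M ^ 3) := le_max_left _ _
    have h' : ((|n| : ℤ) : ℝ) ≤ ((max |n| (M ^ 3) : ℤ) : ℝ) := by exact_mod_cast this
    rwa [Int.cast_abs] at h'
  exact hnle.trans hyb


/-- **vKM Corollary 9.3 (ii), generic in `Ω`** (PROVED; `Ω' = 3Ω(1, S) + 9 log N_S`): *"If `u + v` is a cube in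
`ℚ`, then there is `δ ∈ 𝒪^×` such that `h(δ³u), h(δ³v) ≤ Ω`."* [cite: VonkanelMatschke2023, Cor. 9.3 (ii) (arXiv §9, cor:sumsofunits)] -/
theorem corollary_9_3_ii_general (Ω : Finset ℕ → ℚ → ℝ)
    (hMo : ∀ (S : Finset ℕ), (∀ p ∈ S, p.Prime) → ∀ a : ℚ, a ≠ 0 → IsSInteger S a →
      ∀ x y : ℚ, IsSInteger S x → IsSInteger S y → y ^ 2 = x ^ 3 + a →
        max (logHeight₁ x) (2 / 3 * logHeight₁ y) ≤ Ω S a)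
    (hΩ : ∀ (S : Finset ℕ) (a : ℚ), IsSUnit S a → Ω S a = 1 / 3 * logHeight₁ a + Ω S 1)
    {S : Finset ℕ}
    (hS : ∀ p ∈ S, p.Prime) {u v : ℚ} (hu : IsSUnit S u) (hv : IsSUnit S v) (hcube : ∃ r : ℚ, u + v = r ^ 3) :
    ∃ δ : ℚ, IsSUnit S δ ∧
      max (logHeight₁ (δ ^ 3 * u)) (logHeight₁ (δ ^ 3 * v)) ≤
        3 * Ω S 1 + 9 * Real.log (primesProd S) := by
  obtain ⟨δ, m, n, hδS, hm, hn, hmS, hnS, hcf⟩ := exists_isSUnit_cube_mul_pair hS hu hv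
  obtain ⟨r, hr⟩ := hcube
  -- `m + n = (δ r)³`, and `δ r ∈ ℤ`
  have hsum : ((m + n : ℤ) : ℚ) = (δ * r) ^ 3 := by push_cast; rw [← hm, ← hn, ← mul_add, hr]; ring
  obtain ⟨l, hl⟩ : ∃ l : ℤ, δ * r = l := by
    by_cases h0 : δ * r = 0
    · exact ⟨0, by rw [h0]; simp⟩
    · refine exists_intCast_of_padicValRat_nonneg fun p hp => ?_
      haveI : Fact p.Prime := ⟨hp⟩
      have h1 : 0 ≤ padicValRat p ((δ * r) ^ 3) := by
        rw [← hsum, padicValRat.of_int]; exact_mod_cast Nat.zero_le _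
      rw [padicValRat.pow] at h1
      push_cast at h1; omega
  have hl3 : l ^ 3 = m + n := by
    have : ((l ^ 3 : ℤ) : ℚ) = ((m + n : ℤ) : ℚ) := by rw [hsum, hl]; push_cast; ring
    exact_mod_cast this
  have h1 := claimcube_general Ω hMo hΩ hS hmS hnS hl3 hcf
  have h2 := claimcube_general Ω hMo hΩ hS hnS hmS (by rw [hl3, add_comm]) fun p hp h => hcf p hp ⟨h.2, h.1⟩
  refine ⟨δ, hδS, ?_⟩
  rw [hm, hn]
  exact max_le h2 h1

/-! ### Specialisation to `Ω_opt` -/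

/-- `Ω_opt(a, S) = ⅓h(a) + Ω_opt(1, S)` for `a ∈ 𝒪^×` (`a_S = 1_S`). [cite: VonkanelMatschke2023, §9 (Ω = 3Ω_opt(1,S) + 9 log N_S)] -/
theorem omegaOpt_of_isSUnit {S : Finset ℕ} {a : ℚ} (h : IsSUnit S a) :
    omegaOpt S a = 1 / 3 * logHeight₁ a + omegaOpt S 1 := by
  have hlev : mordellLevel S a = mordellLevel S 1 := by
    rw [show a = a * 1 by ring]; exact mordellLevel_mul_of_isSUnit h one_ne_zero
  rw [omegaOpt_def, omegaOpt_def, hlev, logHeight₁_one]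
  ring

/-- **vKM Corollary 9.3 (`Ω_opt`) ⟸ {Cor. 9.1 (`Ω_opt`), the Mordell half of Prop. 10.7}** (PROVED).
[cite: VonkanelMatschke2023, Cor. 9.3 (arXiv §9, cor:sumsofunits)] -/
theorem corollary_9_3_of_corollary_9_1_of_mordell_omegaOpt (h91 : corollary_9_1)
    (hMo : ∀ (S : Finset ℕ), (∀ p ∈ S, p.Prime) → ∀ a : ℚ, a ≠ 0 → IsSInteger S a →
      ∀ x y : ℚ, IsSInteger S x → IsSInteger S y → y ^ 2 = x ^ 3 + a →
        max (logHeight₁ x) (2 / 3 * logHeight₁ y) ≤ omegaOpt S a) :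
    corollary_9_3 := by
  intro S hS u v hu hv
  exact ⟨fun hsq => corollary_9_3_i_general omegaOpt h91 (fun S a ha => omegaOpt_of_isSUnit ha) hS hu hv hsq,
    fun hcube => corollary_9_3_ii_general omegaOpt hMo (fun S a ha => omegaOpt_of_isSUnit ha) hS hu hv hcube⟩

/-- **vKM Corollary 9.3 (`Ω_opt`) ⟸ {Cor. 9.1 (`Ω_opt`), Prop. 10.7}**. [cite: VonkanelMatschke2023, Cor. 9.3 (arXiv §9, cor:sumsofunits)] -/
theorem corollary_9_3_of_proposition_10_7 (h91 : corollary_9_1) (h107 : proposition_10_7) : corollary_9_3 :=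
  corollary_9_3_of_corollary_9_1_of_mordell_omegaOpt h91 h107.2

/-- **vKM Corollary 9.3 (`Ω_opt`, as printed) ⟸ {modularity, Lemma 10.3, Prop. 10.8 (i)}** (through
`corollary_9_1_of_roots` and `mordell_height_le_omegaOpt_of_lemma_10_3`); the named fact `corollary_9_3` is no
longer an independent root. [cite: VonkanelMatschke2023, Cor. 9.3 (arXiv §9, cor:sumsofunits)] -/
theorem corollary_9_3_of_roots (hmod : nonempty_modularParametrizationData)
    (h103 : vonKanelMatschke_lemma_10_3) (hi : vonKanelMatschke_prop_10_8_i) : corollary_9_3 :=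
  corollary_9_3_of_corollary_9_1_of_mordell_omegaOpt (corollary_9_1_of_roots hmod h103 hi)
    (mordell_height_le_omegaOpt_of_lemma_10_3 hmod h103 hi)

end VonKanelMatschke

end Literature.NumberTheory.DiophantineGeometry

end
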